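import Mathlib
import Literature.NumberTheory.LocalFields.UnramifiedQuadraticNormSurjective

/-!
# STUB-IDEAS k2 (gen 35) — Lean sketch `UniversalNormsK2G35`

Stub of record: `stub_heegnerIndexLowerAtTwo` (route `PrintCf2`, crux
`SplitBadTwoLowerHalfOfFacts`, item `stmt-BirchSwinnertonDyer-27851`; skeleton sha16
`f2bd84c029a8a938`).  Nothing here re-types the stub; BSD is NOT proved by any of this.

Contents (all kernel-checked, no `sorry`; axioms `propext/Classical.choice/Quot.sound` only).
Scope after CRITIC row 100 (k3-g34 `CarrierSquareK3G34` ADOPTED, kill-line K43): the LOAD-BEARING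
sections are §2b (R205″ = B46 PROPER made concrete: the LOCATED index between the coinvariant and
the invariant carrier), §2c (one typed transfer serving R213 N-ONTO and R209 W-TR) and §3 (R211
F-DEG, CLOSED).  §1 is CONTEXT ONLY (K43/B58: compactness / universal norms are NOT on the
LOWER path — `tower_univNorm_eq_prQuot` already gives `U_n = D_n` by choice alone); it is kept
because it is sorry-free and records precisely which hypothesis (surjective transitions /
compactness) the degenerate sandwich makes unnecessary; nothing in §1 is claimed against K43.

* §1 (context) `Tower`: `sections` (= `lim_←`), `imageOfLimit n`, `universalNorms n`;
  `imageOfLimit_eq_universalNorms` for towers of COMPACT HAUSDORFF spaces (Cantor/König), finite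
  corollary, the typed counterexample `shiftTower` (compactness load-bearing in general),
  naturality `Hom.eval_image_range_onSections`.
* §2 twist-invariance of the class / digit receptacles under ANY ring automorphism of a local
  ring (`map_maximalIdeal_ringEquiv`, `map_two_units`) — the unramified-twist arrow (ε) of the
  B46 dictionary is harmless for rows 93/96.
* §2b **B46 located** (R205″ `hexh` for the coinvariant presentation): for an involution `σ` of an
  abelian group `A`, `δ = (1−σ)̄ : A ⧸ (1+σ)A → A` has image EXACTLY `(1−σ)A` (`delta_range`),
  lands in `ker(1+σ)` (`delta_mem_ker_nrm`), kernel EXACTLY the image of `A^σ` (`delta_ker`,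
  = `Ĥ⁰(Δ,A)`), commutes with everything commuting with `σ` (`delta_comm`); and the limit form
  `exists_coherent_lift`: level-wise onto + kernels onto kernels ⇒ `lim Q ↠ lim D`.
* §2c **Serre V §1 Lemma 2 (surjective half), typed**: `mem_map_of_graded_surjective` — graded
  surjective + complete source + separated target ⇒ surjective on `F⁰`; the common abstract
  half of R213 (norm onto `U¹` in unramified steps, Serre V §2 Prop 3 (a)) and R209 (`Tr` onto
  `𝕎(k_n)`).
* §2d **R213 (N-ONTO) is a TREE THEOREM — typed transfer**: `normOntoPrincipal_transfer(_maximalIdeal)`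
  derives «every `σ`-fixed `u ≡ 1 (𝔪)` is `s·σ s`, `s ≡ 1 (𝔪)`» (= `N(U¹_{L_{m+1}}) = U¹_{L_m}` for a
  quadratic unramified step) from `Literature.NumberTheory.LocalFields.UnramifiedQuadraticNorm.
  exists_mul_map_eq_of_sub_one_mem` + `HermitianFormsHensel.exists_add_map_eq_one_of_isUnit_sub`
  (Serre V §2 Prop. 3 (a), ALREADY formalised, seat `lit-hodgefound` g33); residual = frame glue
  (unit ball in `IsNonarchimedeanLocalField` currency: Mathlib `IsAdicComplete 𝓂[K] 𝒪[K]` + tree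
  `isNonarchimedeanLocalField_of_normedField`, `integer_valuation_ofValuation_eq`) + the
  unramifiedness witness `IsUnit (τ a − a)`; and for R209 (W-TR) the unit trick
  `surjective_of_isUnit_apply` / `isUnit_apply_of_not_mem`.
* §3 **R211 CLOSED** (class ledger after row 101 / B59): `cyclotomic_twelve` (`Φ₁₂ = X⁴ − X² + 1` over any commutative ring) and
  `cyclotomicTwelveIrreducible : Irreducible (Polynomial.cyclotomic 12 ℚ_[2])` — exactly the
  statement `WittTowerK3G33.CyclotomicTwelveIrreducible` (k3-g33, F-DEG), proved by Gauss's lemma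
  over `ℤ₂` and a `decide` over `ℤ/4`.
-/

open Set Topology Polynomial

namespace Summit.BirchSwinnertonDyer.BirchSwinnertonDyer.Cruxes.SplitBadTwoLowerHalfOfFacts.UniversalNormsK2G35

universe u

/-! ## §1 (CONTEXT ONLY — not claimed against K43/B58) Towers, the image of the limit, universal norms

After row 100 the LOWER path needs none of this: `N(S_{m+1}) = D_m` makes `U_n = D_n` a
choice-only statement (`CarrierSquareK3G34.tower_univNorm_eq_prQuot`).  The general theorem below
(`imageOfLimit_eq_universalNorms`, compact Hausdorff towers) and its counterexample record what the
degenerate sandwich saves; they may serve the VALUE side's universal-norm rule B48 (ii) for towers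
whose transitions are not onto, and are otherwise inert. -/

/-- An `ℕ`-indexed tower (inverse system) of types: transition maps `π h : X m → X n` for every
`n ≤ m`, strictly functorial.  (Model: `X m = S_m = U¹(L_m)^{N_σ = 1} = H¹(F_m, T(key))`,
`π` = the norm / corestriction maps of the unramified `ℤ₂`-tower at `v`.) -/
structure Tower where
  /-- the layers -/
  X : ℕ → Type u
  /-- transition maps `X m → X n`, `n ≤ m` -/
  π : ∀ ⦃m n : ℕ⦄, n ≤ m → X m → X n
  π_rfl : ∀ (n : ℕ) (x : X n), π le_rfl x = x
  π_comp : ∀ ⦃k m n : ℕ⦄ (hmk : m ≤ k) (hnm : n ≤ m) (x : X k), π hnm (π hmk x) = π (hnm.trans hmk) x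

namespace Tower

variable (T : Tower.{u})

/-- Coherent sequences: the inverse limit `lim_← X_m` as a subset of the product. -/
def sections : Set (∀ n, T.X n) := {s | ∀ ⦃m n : ℕ⦄ (h : n ≤ m), T.π h (s m) = s n}

/-- `U_n := Im(lim_← X_m → X_n)`, the image of the limit in layer `n`. -/
def imageOfLimit (n : ℕ) : Set (T.X n) := {x | ∃ s ∈ T.sections, s n = x}

/-- Universal norms of layer `n`: `⋂_{m ≥ n} Im(X_m → X_n)`. -/
def universalNorms (n : ℕ) : Set (T.X n) := ⋂ (m : ℕ) (h : n ≤ m), Set.range (T.π h)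

/-- Trivial half: an element coming from the limit is a universal norm. -/
theorem imageOfLimit_subset_universalNorms (n : ℕ) : T.imageOfLimit n ⊆ T.universalNorms n := by
  rintro x ⟨s, hs, rfl⟩
  simp only [universalNorms, Set.mem_iInter, Set.mem_range]
  intro m h
  exact ⟨s m, hs h⟩

/-- **The image of the limit IS the module of universal norms** for towers of compact Hausdorff
spaces with continuous transition maps (in the application: finitely generated `ℤ₂`-modules
`S_m` with the `2`-adic topology and `ℤ₂`-linear norm maps).  Proof: for a universal norm `x`,
the sets `A_M` of sequences through `x` coherent up to level `M + n` are closed, nonempty and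
decreasing in the compact product `∏ X_k`; Cantor's intersection theorem gives a coherent
sequence through `x`.  [Coates–Sujatha, *Cyclotomic Fields and Zeta Values*, (4.17)–(4.18);
Serre, *Local Fields* XI §? Prop. 5 `N_{F/E} D_F = D_E`; Bourbaki TG I §9.6] -/
theorem imageOfLimit_eq_universalNorms [∀ n, TopologicalSpace (T.X n)]
    [∀ n, CompactSpace (T.X n)] [∀ n, T2Space (T.X n)]
    (hπ : ∀ ⦃m n : ℕ⦄ (h : n ≤ m), Continuous (T.π h)) (n : ℕ) :
    T.imageOfLimit n = T.universalNorms n := by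
  classical
  refine (T.imageOfLimit_subset_universalNorms n).antisymm ?_
  intro x hx
  simp only [universalNorms, Set.mem_iInter, Set.mem_range] at hx
  -- every layer is inhabited
  have hX : ∀ k, Nonempty (T.X k) := fun k => by
    by_cases hk : n ≤ k
    · obtain ⟨z, _⟩ := hx k hk
      exact ⟨z⟩
    · exact ⟨T.π (le_of_not_ge hk) x⟩
  -- the closed sets `A M`
  let A : ℕ → Set (∀ k, T.X k) := fun M =>
    {s | s n = x} ∩ ⋂ (m : ℕ) (k : ℕ) (hkm : k ≤ m) (_ : m ≤ M + n), {s | T.π hkm (s m) = s k}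
  have hmemA : ∀ (M : ℕ) (s : ∀ k, T.X k), s ∈ A M ↔
      s n = x ∧ ∀ (m k : ℕ) (hkm : k ≤ m), m ≤ M + n → T.π hkm (s m) = s k := by
    intro M s
    simp only [A, Set.mem_inter_iff, Set.mem_setOf_eq, Set.mem_iInter]
  have hanti : ∀ M, A (M + 1) ⊆ A M := by
    intro M s hs
    rw [hmemA] at hs ⊢
    exact ⟨hs.1, fun m k hkm hm => hs.2 m k hkm (by omega)⟩
  have hne : ∀ M, (A M).Nonempty := by
    intro M
    obtain ⟨y, hy⟩ := hx (M + n) (by omega)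
    refine ⟨fun k => if hk : k ≤ M + n then T.π hk y else (hX k).some, ?_⟩
    rw [hmemA]
    refine ⟨?_, ?_⟩
    · simp only [dif_pos (show n ≤ M + n by omega)]
      exact hy
    · intro m k hkm hm
      have hk : k ≤ M + n := hkm.trans hm
      simp only [dif_pos hm, dif_pos hk]
      exact T.π_comp hm hkm y
  have hclosed : ∀ M, IsClosed (A M) := by
    intro M
    refine (isClosed_eq (continuous_apply n) continuous_const).inter ?_
    refine isClosed_iInter fun m => isClosed_iInter fun k => isClosed_iInter fun hkm =>
      isClosed_iInter fun _ => ?_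
    exact isClosed_eq ((hπ hkm).comp (continuous_apply m)) (continuous_apply k)
  have hcpt : IsCompact (A 0) := (hclosed 0).isCompact
  obtain ⟨s, hs⟩ :=
    IsCompact.nonempty_iInter_of_sequence_nonempty_isCompact_isClosed A hanti hne hcpt hclosed
  simp only [Set.mem_iInter] at hs
  refine ⟨s, ?_, ((hmemA 0 s).1 (hs 0)).1⟩
  intro m k hkm
  exact ((hmemA m s).1 (hs m)).2 m k hkm (by omega)

/-- Finite layers (e.g. `S_m / 2^j`, or finite coefficient modules): same conclusion, via the
discrete topology. -/
theorem imageOfLimit_eq_universalNorms_of_finite [∀ n, Finite (T.X n)] (n : ℕ) :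
    T.imageOfLimit n = T.universalNorms n := by
  letI : ∀ n, TopologicalSpace (T.X n) := fun _ => ⊥
  haveI : ∀ n, DiscreteTopology (T.X n) := fun _ => ⟨rfl⟩
  exact T.imageOfLimit_eq_universalNorms (fun m n h => continuous_of_discreteTopology) n

/-- A morphism of towers (model: `g_m = log₂/(2√u) : S_m → 𝒪_{F_m}`, norm ↦ trace). -/
structure Hom (S Y : Tower.{u}) where
  /-- the level maps -/
  app : ∀ n, S.X n → Y.X n
  comm : ∀ ⦃m n : ℕ⦄ (h : n ≤ m) (x : S.X m), Y.π h (app m x) = app n (S.π h x)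

variable {T} {Y : Tower.{u}}

/-- The induced map on inverse limits `G = lim g_m`. -/
def Hom.onSections (g : Hom T Y) : T.sections → Y.sections := fun s =>
  ⟨fun n => g.app n (s.1 n), fun m n h => by rw [g.comm h]; exact congrArg (g.app n) (s.2 h)⟩

@[simp] theorem Hom.onSections_apply (g : Hom T Y) (s : T.sections) (n : ℕ) :
    (g.onSections s).1 n = g.app n (s.1 n) := rfl

/-- **Naturality (R205′ (vii), generic form):** `ev_n(G(lim S)) = g_n(U_n)` — the image in layer
`n` of the image of the limit map is the level map applied to the universal-norm receptacle. -/
theorem Hom.eval_image_range_onSections (g : Hom T Y) (n : ℕ) :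
    (fun t : Y.sections => t.1 n) '' Set.range g.onSections = g.app n '' T.imageOfLimit n := by
  ext y
  simp only [Set.mem_image, Set.mem_range, imageOfLimit, Set.mem_setOf_eq]
  constructor
  · rintro ⟨t, ⟨s, rfl⟩, rfl⟩
    exact ⟨s.1 n, ⟨s.1, s.2, rfl⟩, rfl⟩
  · rintro ⟨_, ⟨s, hs, rfl⟩, rfl⟩
    exact ⟨g.onSections ⟨s, hs⟩, ⟨⟨s, hs⟩, rfl⟩, rfl⟩

/-- The image of universal norms under a tower map consists of universal norms (no topology). -/
theorem Hom.mapsTo_universalNorms (g : Hom T Y) (n : ℕ) :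
    Set.MapsTo (g.app n) (T.universalNorms n) (Y.universalNorms n) := by
  intro x hx
  simp only [universalNorms, Set.mem_iInter, Set.mem_range] at hx ⊢
  intro m h
  obtain ⟨z, rfl⟩ := hx m h
  exact ⟨g.app m z, g.comm h z⟩

end Tower

/-! ### Compactness is load-bearing: a discrete counterexample

All layers `ℕ`; transition `X_m → X_n` (`1 ≤ n ≤ m`) is the shift `k ↦ k + (m − n)`, and
`X_m → X_0` is the constant map `0` for `m ≥ 1`.  Then `0 ∈ X_0` is a universal norm, but the
limit is EMPTY (a coherent sequence would have `s_1 = s_{m+1} + m ≥ m` for all `m`), so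
`imageOfLimit 0 = ∅ ≠ {0} = universalNorms 0`. -/

/-- Transition maps of the shift tower. -/
def shiftπ (m n x : ℕ) : ℕ := if n = 0 then (if m = 0 then x else 0) else x + (m - n)

/-- The shift tower (discrete, non-compact layers). -/
abbrev shiftTower : Tower.{0} where
  X := fun _ => ℕ
  π := fun m n _ x => shiftπ m n x
  π_rfl := by
    intro n x
    show shiftπ n n x = x
    unfold shiftπ
    split_ifs <;> omega
  π_comp := by
    intro k m n hmk hnm x
    show shiftπ m n (shiftπ k m x) = shiftπ k n x
    unfold shiftπ
    split_ifs <;> omega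

theorem shiftTower_sections_eq_empty : shiftTower.sections = ∅ := by
  ext s
  simp only [Tower.sections, Set.mem_setOf_eq, Set.mem_empty_iff_false, iff_false]
  intro hs
  let t : ℕ → ℕ := fun n => s n
  have h : ∀ m : ℕ, t (m + 1) + m = t 1 := by
    intro m
    have := hs (show 1 ≤ m + 1 by omega)
    change shiftπ (m + 1) 1 (t (m + 1)) = t 1 at this
    simpa [shiftπ] using this
  have := h (t 1 + 1)
  omega

theorem shiftTower_imageOfLimit_zero : shiftTower.imageOfLimit 0 = ∅ := by
  simp [Tower.imageOfLimit, shiftTower_sections_eq_empty]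

theorem shiftTower_universalNorms_zero : shiftTower.universalNorms 0 = {0} := by
  ext u
  simp only [Tower.universalNorms, Set.mem_iInter, Set.mem_range, Set.mem_singleton_iff]
  constructor
  · intro h
    obtain ⟨y, hy⟩ := h 1 (by omega)
    change shiftπ 1 0 y = u at hy
    simpa [shiftπ, eq_comm] using hy
  · rintro rfl (_ | m) h
    · exact ⟨0, by change shiftπ 0 0 0 = 0; simp [shiftπ]⟩
    · exact ⟨0, by change shiftπ (m + 1) 0 0 = 0; simp [shiftπ]⟩

/-- Without compactness `Im(lim) ≠ universal norms` can happen. -/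
theorem imageOfLimit_ne_universalNorms_example :
    shiftTower.imageOfLimit 0 ≠ shiftTower.universalNorms 0 := by
  rw [shiftTower_imageOfLimit_zero, shiftTower_universalNorms_zero]
  exact (Set.singleton_nonempty 0).ne_empty.symm

/-! ## §2 The unramified-twist arrow is harmless for the class and the digit receptacles

Arrow (ε) of the dictionary identifies `H¹_Iw(F_∞, T ⊗ η) ≅ H¹_Iw(F_∞, T)(η)` for a character
`η` of `Γ_v` (Loeffler–Zerbes, arXiv:1108.5954, Lemma 2.4 / (eq:iwacohotwist)): the underlying
compact group and its maps to the layers are unchanged, only the `Λ_v`-action is moved by the ring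
automorphism `Tw_η : γ ↦ η(γ)γ`.  The two receptacles the stub consumes — the CLASS `𝔪_v` (row 93)
and the DIGIT set `2·Λ_vˣ` (row 88) — are stable under every ring automorphism. -/

section Twist

variable {R : Type*} [CommRing R]

/-- Any ring automorphism of a local ring maps the maximal ideal onto itself. -/
theorem map_maximalIdeal_ringEquiv [IsLocalRing R] (e : R ≃+* R) :
    (IsLocalRing.maximalIdeal R).map (e : R →+* R) = IsLocalRing.maximalIdeal R := by
  apply le_antisymm
  · rw [Ideal.map_le_iff_le_comap]
    intro x hx
    rw [Ideal.mem_comap, IsLocalRing.mem_maximalIdeal, mem_nonunits_iff]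
    intro hu
    exact (IsLocalRing.mem_maximalIdeal _ |>.1 hx) ((isUnit_map_iff (e : R →+* R) x).1 hu)
  · intro x hx
    have hx' : e.symm x ∈ IsLocalRing.maximalIdeal R := by
      rw [IsLocalRing.mem_maximalIdeal, mem_nonunits_iff] at hx ⊢
      intro hu
      exact hx (by simpa using (isUnit_map_iff (e : R →+* R) (e.symm x)).2 hu)
    have := Ideal.mem_map_of_mem (e : R →+* R) hx'
    simpa using this

/-- Any ring automorphism maps the digit set `2·Rˣ` onto itself. -/
theorem map_two_units (e : R ≃+* R) (r : R) (hr : ∃ w : Rˣ, r = 2 * w) :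
    ∃ w : Rˣ, e r = 2 * w := by
  obtain ⟨w, rfl⟩ := hr
  exact ⟨Units.map (e : R →* R) w, by simp [map_ofNat]⟩

end Twist

/-! ## §2b B46 located: the coinvariant carrier versus the invariant carrier

For an involution `σ` of an abelian group `A` (model: `A = U¹(L_m)` written additively,
`σ = σ_m`, `Δ = ⟨σ⟩`): the COINVARIANT (quotient, "`χ_u`-quotient") carrier is
`Q := A ⧸ (1+σ)A`, the INVARIANT (projection-free, B46) carrier is `S := ker(1+σ) ⊇ D := (1−σ)A`.
The comparison map is `δ := (1−σ)̄ : Q → A`; it lands in `S`, has image EXACTLY `D`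
(`delta_range`) and kernel EXACTLY the image of `A^σ = ker(1−σ)` in `Q`, i.e.
`ker δ ≅ A^σ/(1+σ)A = Ĥ⁰(Δ, A)` (`delta_ker`).  In the model `Ĥ⁰(Δ, U¹(L_m)) = U¹(F_m)/N U¹(L_m)
≅ I(L_m/F_m) = ℤ/2` (Harari, *Galois cohomology and CFT*, Lemma 9.8 (b) + Cor. 9.15; Serre,
*Local Fields* XIV §6) and the norm transitions on these kernels are the restriction maps
`Gal(L_{m+1}/F_{m+1}) ⥲ Gal(L_m/F_m)` (Harari Prop. 9.7 (a)), bijective; with row 100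
(`N(S_{m+1}) = D_m`) the limit statement is `exists_coherent_lift` below:
`lim_N Q_m ↠ lim_N D_m = lim_N S_m` with kernel `lim Ĥ⁰ = ℤ/2` — `hexh` of R205″ for the
coinvariant presentation, the "2-power index between the carriers" LOCATED as a kernel of order 2
(torsion, killed by `g = log`), cokernel `0`, no effect on `h`. -/

section Carriers

variable {A : Type*} [AddCommGroup A] (σ : A →+ A)

/-- `N_Δ = 1 + σ`. -/
def nrm : A →+ A := AddMonoidHom.id A + σ

/-- `1 − σ`. -/
def dlt : A →+ A := AddMonoidHom.id A - σ

@[simp] theorem nrm_apply (a : A) : nrm σ a = a + σ a := rfl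

@[simp] theorem dlt_apply (a : A) : dlt σ a = a - σ a := rfl

variable {σ}

theorem dlt_nrm (hσ : ∀ a, σ (σ a) = a) (a : A) : dlt σ (nrm σ a) = 0 := by
  simp only [dlt_apply, nrm_apply, map_add, hσ]
  abel

theorem nrm_dlt (hσ : ∀ a, σ (σ a) = a) (a : A) : nrm σ (dlt σ a) = 0 := by
  simp only [dlt_apply, nrm_apply, map_sub, hσ]
  abel

/-- `(1+σ)A ⊆ A^σ = ker(1−σ)`. -/
theorem range_nrm_le_ker_dlt (hσ : ∀ a, σ (σ a) = a) : (nrm σ).range ≤ (dlt σ).ker := by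
  rintro _ ⟨a, rfl⟩
  exact (AddMonoidHom.mem_ker).2 (dlt_nrm hσ a)

/-- `(1−σ)A ⊆ S = ker(1+σ)`. -/
theorem range_dlt_le_ker_nrm (hσ : ∀ a, σ (σ a) = a) : (dlt σ).range ≤ (nrm σ).ker := by
  rintro _ ⟨a, rfl⟩
  exact (AddMonoidHom.mem_ker).2 (nrm_dlt hσ a)

/-- The comparison map `δ = (1−σ)̄ : A ⧸ (1+σ)A →+ A` (coinvariant carrier → invariant carrier). -/
def delta (hσ : ∀ a, σ (σ a) = a) : A ⧸ (nrm σ).range →+ A :=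
  QuotientAddGroup.lift (nrm σ).range (dlt σ) (range_nrm_le_ker_dlt hσ)

theorem delta_mk (hσ : ∀ a, σ (σ a) = a) (a : A) :
    delta hσ (QuotientAddGroup.mk a) = a - σ a := rfl

/-- `δ` lands in the invariant carrier `S = ker(1+σ)`. -/
theorem delta_mem_ker_nrm (hσ : ∀ a, σ (σ a) = a) (q : A ⧸ (nrm σ).range) :
    delta hσ q ∈ (nrm σ).ker := by
  refine QuotientAddGroup.induction_on q fun a => ?_
  exact (AddMonoidHom.mem_ker).2 (nrm_dlt hσ a)

/-- **The image of the coinvariant carrier is EXACTLY `D = (1−σ)A`** (in the model: `D_m`, which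
is all of the norm-coherent part by row 100 — cokernel `0` in the limit). -/
theorem delta_range (hσ : ∀ a, σ (σ a) = a) : (delta hσ).range = (dlt σ).range := by
  ext x
  constructor
  · rintro ⟨q, rfl⟩
    obtain ⟨a, rfl⟩ := QuotientAddGroup.mk_surjective q
    exact ⟨a, rfl⟩
  · rintro ⟨a, rfl⟩
    exact ⟨QuotientAddGroup.mk a, rfl⟩

/-- **The kernel of the comparison is EXACTLY `A^σ/(1+σ)A = Ĥ⁰(Δ, A)`** (the image of
`A^σ = ker(1−σ)` in the quotient): the LOCATED `2`-power index between the two carriers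
(in the model `≅ U¹(F_m)/N U¹(L_m) ≅ ℤ/2`, local class field theory). -/
theorem delta_ker (hσ : ∀ a, σ (σ a) = a) :
    (delta hσ).ker = ((dlt σ).ker).map (QuotientAddGroup.mk' (nrm σ).range) :=
  QuotientAddGroup.ker_lift _ _ _

/-- `δ` commutes with every endomorphism commuting with `σ` (model: the `Γ`-action, `Γ × Δ`
abelian — row 100's `hcomm`), so `δ` is `ℤ₂⟦Γ⟧`-linear once both carriers are. -/
theorem delta_comm (hσ : ∀ a, σ (σ a) = a) (γ : A →+ A) (hγ : ∀ a, γ (σ a) = σ (γ a)) (a : A) :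
    delta hσ (QuotientAddGroup.mk (γ a)) = γ (delta hσ (QuotientAddGroup.mk a)) := by
  simp [delta_mk, map_sub, hγ]

end Carriers

/-! ### Lifting coherent sequences through level-wise extensions (the limit form of B46)

One-step towers of abelian groups `Q_{m+1} → Q_m`, `D_{m+1} → D_m`, level maps `f_m : Q_m ↠ D_m`
compatible with the transitions, and kernels mapping ONTO kernels (model: `Ĥ⁰` transitions =
restriction isomorphisms).  Then every coherent sequence of `D`'s lifts to a coherent sequence of
`Q`'s: `lim Q ↠ lim D`.  (Mittag–Leffler for a surjective kernel system, by dependent choice.) -/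

section Lift

variable {Q D : ℕ → Type*} [∀ m, AddCommGroup (Q m)] [∀ m, AddCommGroup (D m)]
  (tQ : ∀ m, Q (m + 1) →+ Q m) (tD : ∀ m, D (m + 1) →+ D m) (f : ∀ m, Q m →+ D m)

/-- **`lim Q ↠ lim D`** when the level maps are onto, compatible, and map kernels onto kernels. -/
theorem exists_coherent_lift
    (hcomm : ∀ m (x : Q (m + 1)), tD m (f (m + 1) x) = f m (tQ m x))
    (hsurj : ∀ m, Function.Surjective (f m))
    (hker : ∀ m (k : Q m), f m k = 0 → ∃ k' : Q (m + 1), f (m + 1) k' = 0 ∧ tQ m k' = k)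
    (d : ∀ m, D m) (hd : ∀ m, tD m (d (m + 1)) = d m) :
    ∃ x : ∀ m, Q m, (∀ m, tQ m (x (m + 1)) = x m) ∧ ∀ m, f m (x m) = d m := by
  classical
  -- one step: from a lift at level `m` to a compatible lift at level `m+1`
  have step : ∀ m (xm : {x : Q m // f m x = d m}),
      ∃ y : Q (m + 1), f (m + 1) y = d (m + 1) ∧ tQ m y = xm.1 := by
    intro m xm
    obtain ⟨y₀, hy₀⟩ := hsurj (m + 1) (d (m + 1))
    have hk : f m (xm.1 - tQ m y₀) = 0 := by
      rw [map_sub, xm.2, ← hcomm, hy₀, hd, sub_self]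
    obtain ⟨k', hk'0, hk'⟩ := hker m _ hk
    refine ⟨y₀ + k', ?_, ?_⟩
    · rw [map_add, hy₀, hk'0, add_zero]
    · rw [map_add, hk']
      abel
  let next : ∀ m, {x : Q m // f m x = d m} → {x : Q (m + 1) // f (m + 1) x = d (m + 1)} :=
    fun m xm => ⟨(step m xm).choose, (step m xm).choose_spec.1⟩
  obtain ⟨x₀, hx₀⟩ := hsurj 0 (d 0)
  let xs : ∀ m, {x : Q m // f m x = d m} :=
    fun m => Nat.rec (motive := fun m => {x : Q m // f m x = d m}) ⟨x₀, hx₀⟩ (fun m xm => next m xm) m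
  refine ⟨fun m => (xs m).1, fun m => ?_, fun m => (xs m).2⟩
  show tQ m (next m (xs m)).1 = (xs m).1
  exact (step m (xs m)).choose_spec.2

/-- The kernel of `lim f` is `lim ker f` (trivial half, for the record): a coherent sequence
mapping to `0` at every level lies level-wise in the kernels. -/
theorem coherent_ker (x : ∀ m, Q m) (hx : ∀ m, f m (x m) = 0) (m : ℕ) : x m ∈ (f m).ker :=
  (AddMonoidHom.mem_ker).2 (hx m)

end Lift

/-! ## §2c One typed transfer for R213 (N-ONTO) and R209 (W-TR onto): Serre V §1 Lemma 2

Serre, *Local Fields* V §1 Lemma 2 (surjective half): a homomorphism of filtered abelian groups,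
compatible with the filtrations, with SURJECTIVE graded pieces, COMPLETE source and SEPARATED
target, is surjective.  Instantiations (the dictionary): (R213) `A = U¹(L_{m+1})`,
`B = U¹(L_m)`, `u = N_{L_{m+1}/L_m}`, `FA n = U^{(n+1)}`, graded pieces = residue trace
(Serre V §2 Prop. 1 / Prop. 3 (a), unramified step); (R209) `A = 𝕎(k_{n+1})`, `B = 𝕎(k_n)`,
`u = Tr`, `FA i = 2^i 𝕎`, graded pieces = residue trace twisted by Frobenius; in both cases the
residue trace of a finite separable extension is onto (Mathlib `Algebra.trace`, nondegenerate
trace form). -/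

section Serre

variable {A B : Type*} [AddCommGroup A] [AddCommGroup B]

/-- **Serre V §1 Lemma 2 (surjective half), typed.** `FA`, `FB` decreasing filtrations by
subgroups, `u(FA n) ⊆ FB n`, graded surjectivity `FB n ⊆ u(FA n) + FB (n+1)`, `A` complete
(every `FA`-adapted series has a sum modulo every `FA n`), `B` separated (`⋂ FB n = 0`):
then `FB 0 ⊆ u(FA 0)`. -/
theorem mem_map_of_graded_surjective (FA : ℕ → AddSubgroup A) (FB : ℕ → AddSubgroup B)
    (u : A →+ B) (hu : ∀ n, (FA n).map u ≤ FB n)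
    (hgr : ∀ n, ∀ b ∈ FB n, ∃ a ∈ FA n, b - u a ∈ FB (n + 1))
    (hcomplete : ∀ a : ℕ → A, (∀ n, a n ∈ FA n) →
      ∃ x : A, ∀ n, x - (Finset.range n).sum a ∈ FA n)
    (hsep : ∀ b : B, (∀ n, b ∈ FB n) → b = 0)
    (b : B) (hb : b ∈ FB 0) : ∃ a ∈ FA 0, u a = b := by
  classical
  -- successive approximation: `bs (n+1) = bs n - u (as n)` with `bs n ∈ FB n`, `as n ∈ FA n`
  let next : ∀ n, {b' : B // b' ∈ FB n} → {b' : B // b' ∈ FB (n + 1)} := fun n t =>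
    ⟨t.1 - u (hgr n t.1 t.2).choose, (hgr n t.1 t.2).choose_spec.2⟩
  let bs : ∀ n, {b' : B // b' ∈ FB n} :=
    fun n => Nat.rec (motive := fun n => {b' : B // b' ∈ FB n}) ⟨b, hb⟩ (fun n t => next n t) n
  let as : ℕ → A := fun n => (hgr n (bs n).1 (bs n).2).choose
  have has : ∀ n, as n ∈ FA n := fun n => (hgr n (bs n).1 (bs n).2).choose_spec.1
  have hbs_succ : ∀ n, (bs (n + 1)).1 = (bs n).1 - u (as n) := fun n => rfl
  have hbs0 : (bs 0).1 = b := rfl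
  -- invariant: `bs n = b - u (∑_{i<n} as i)`
  have hinv : ∀ n, (bs n).1 = b - u ((Finset.range n).sum as) := by
    intro n
    induction n with
    | zero => simp [hbs0]
    | succ n ih => rw [hbs_succ, ih, Finset.sum_range_succ, map_add]; abel
  obtain ⟨x, hx⟩ := hcomplete as has
  refine ⟨x, by simpa using hx 0, ?_⟩
  -- `u x - b ∈ FB n` for every `n`
  have key : ∀ n, u x - b ∈ FB n := by
    intro n
    have h1 : u (x - (Finset.range n).sum as) ∈ FB n :=
      hu n ⟨x - (Finset.range n).sum as, hx n, rfl⟩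
    have h2 : (bs n).1 ∈ FB n := (bs n).2
    have : u x - b = u (x - (Finset.range n).sum as) - (bs n).1 := by
      rw [hinv n, map_sub]; abel
    rw [this]
    exact sub_mem h1 h2
  have := hsep _ key
  exact (sub_eq_zero.1 this)

end Serre

/-! ## §2d R213 (N-ONTO) IS ALREADY A TREE THEOREM — the typed transfer

PRESEARCH HIT (tree, not print): `Literature.NumberTheory.LocalFields.UnramifiedQuadraticNorm`
(`UnramifiedQuadraticNormSurjective.lean`, seat `lit-hodgefound-p11` g33) formalises Serre V §2 Prop. 3 (a)
for a QUADRATIC involution over a complete ring: `exists_mul_map_eq_of_sub_one_mem` — «every `σ`-fixed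
`u ≡ 1 (mod I)` is `s·σ(s)` with `s ≡ 1 (mod I)`», hypotheses `IsAdicComplete I R`, `σ² = 1`, `σ(I) ⊆ I`,
`t + σ t = 1` for some `t`; and `HermitianFormsHensel.exists_add_map_eq_one_of_isUnit_sub` produces `t` from
the UNRAMIFIEDNESS WITNESS `IsUnit (σ a − a)` over a local ring.  Dictionary to k3-g34's sub-stub
`CarrierSquareK3G34.NormOntoPrincipal (L m) (L (m+1))`: `R ↦ 𝒪_{L_{m+1}}` (closed unit ball),
`I ↦ 𝔪_{L_{m+1}}` (open unit ball), `σ ↦ τ_m|_R` (generator of `Gal(L_{m+1}/L_m)`, an isometry — R214's `τ`),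
`R^σ ∩ (1 + I) ↦ U¹(L_m)` (`IsPrincipal`), `s·σ s ↦ algebraMap (Algebra.norm (L m) s)` (R214's `hNτ`),
`IsUnit (σ a − a) ↦` "the step is UNRAMIFIED" (residue involution `≠ id`).  What is LEFT of R213 after the
transfer is frame glue only: (G1) `IsAdicComplete 𝔪 𝒪_{L_{m+1}}` for the unit ball of a proper ultrametric
`ℚ₂`-algebra field (compact + discretely valued), (G2) restriction of `τ` to the unit ball, (G3) the
unramifiedness witness of each step — an INPUT the tower's construction must carry (it is where "unramified
`ℤ₂`-direction" is actually used). -/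

section SerreTransfer

open Literature.NumberTheory.LocalFields Literature.LinearAlgebra.Matrix

/-- **R213, abstract-ring form, PROVED from the tree**: complete local ring `R` (for `I`), involution `σ`
with `σ(I) ⊆ I`, unramifiedness witness `IsUnit (σ a − a)`; then `N(U¹_L) = U¹_K`: every `σ`-fixed
`u ≡ 1 (mod I)` is `s·σ s` with `s ≡ 1 (mod I)`. -/
theorem normOntoPrincipal_transfer {R : Type*} [CommRing R] [IsLocalRing R] {I : Ideal R}
    [IsAdicComplete I R] (σ : R →+* R) (hσ : ∀ a, σ (σ a) = a) (hσI : ∀ a ∈ I, σ a ∈ I)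
    {a : R} (ha : IsUnit (σ a - a)) {u : R} (hσu : σ u = u) (hu1 : u - 1 ∈ I) :
    ∃ s : R, s * σ s = u ∧ s - 1 ∈ I := by
  obtain ⟨t, ht⟩ := HermitianFormsHensel.exists_add_map_eq_one_of_isUnit_sub σ hσ ha
  exact UnramifiedQuadraticNorm.exists_mul_map_eq_of_sub_one_mem σ hσ hσI ht hσu hu1

/-- The same with `I = 𝔪` (`σ(𝔪) ⊆ 𝔪` is automatic for an involution of a local ring —
tree `UnramifiedQuadraticNorm.map_mem_maximalIdeal`). -/
theorem normOntoPrincipal_transfer_maximalIdeal {R : Type*} [CommRing R] [IsLocalRing R]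
    [IsAdicComplete (IsLocalRing.maximalIdeal R) R] (σ : R →+* R) (hσ : ∀ a, σ (σ a) = a)
    {a : R} (ha : IsUnit (σ a - a)) {u : R} (hσu : σ u = u)
    (hu1 : u - 1 ∈ IsLocalRing.maximalIdeal R) :
    ∃ s : R, s * σ s = u ∧ s - 1 ∈ IsLocalRing.maximalIdeal R :=
  normOntoPrincipal_transfer σ hσ (UnramifiedQuadraticNorm.map_mem_maximalIdeal σ hσ) ha hσu hu1

/-- **R209 (W-TR onto), the cheap route**: a linear functional over a commutative ring that takes ONE unit
value is onto (model: `Tr : 𝕎(k_{n+1}) → 𝕎(k_n)` is `𝕎(k_n)`-linear and `Tr x̄ ≠ 0` for some residue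
`x̄` — `Algebra.trace_surjective` for the finite separable residue extension — so `Tr x` is a unit of the
local ring `𝕎(k_n)`).  No completeness, no filtration. -/
theorem surjective_of_isUnit_apply {W M : Type*} [CommRing W] [AddCommGroup M] [Module W M]
    (T : M →ₗ[W] W) {x : M} (hx : IsUnit (T x)) : Function.Surjective T := by
  intro c
  obtain ⟨v, hv⟩ := hx
  refine ⟨(c * ↑v⁻¹) • x, ?_⟩
  rw [map_smul, smul_eq_mul, ← hv, mul_assoc, Units.inv_mul, mul_one]

/-- In a local ring a value outside `𝔪` is a unit value (the residue form of the hypothesis above). -/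
theorem isUnit_apply_of_not_mem {W M : Type*} [CommRing W] [IsLocalRing W] [AddCommGroup M]
    [Module W M] (T : M →ₗ[W] W) {x : M} (hx : T x ∉ IsLocalRing.maximalIdeal W) : IsUnit (T x) := by
  by_contra h
  exact hx ((IsLocalRing.mem_maximalIdeal _).2 h)

end SerreTransfer

/-! ## §3 R211: `Φ₁₂` is irreducible over `ℚ₂` -/

section CyclotomicTwelve

/-- `Φ₁₂ = X⁴ − X² + 1` over any commutative ring (`Φ₁₂ = Φ₆(X²)`, Mathlib `cyclotomic_six`,
`cyclotomic_expand_eq_cyclotomic`). -/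
theorem cyclotomic_twelve (R : Type*) [CommRing R] :
    cyclotomic 12 R = X ^ 4 - X ^ 2 + 1 := by
  have h := cyclotomic_expand_eq_cyclotomic Nat.prime_two (show 2 ∣ 6 by norm_num) R
  rw [cyclotomic_six] at h
  rw [show (12 : ℕ) = 6 * 2 by norm_num, ← h]
  simp only [map_add, map_sub, map_one, map_pow, expand_X]
  ring

/-- Coefficients of a product of two monic quadratics equal to `X⁴ − X² + 1`. -/
theorem coeffs_of_quad_mul_quad {R : Type*} [CommRing R] {a b c d : R}
    (h : (X ^ 2 + C a * X + C b) * (X ^ 2 + C c * X + C d) = (X ^ 4 - X ^ 2 + 1 : R[X])) :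
    a + c = 0 ∧ a * c + b + d = -1 ∧ b * d = 1 := by
  have e : (X ^ 2 + C a * X + C b) * (X ^ 2 + C c * X + C d)
      = X ^ 4 + C (a + c) * X ^ 3 + C (a * c + b + d) * X ^ 2 + C (a * d + b * c) * X
        + C (b * d) := by
    simp only [map_add, map_mul]
    ring
  rw [e] at h
  have h3 := congrArg (fun q : R[X] => q.coeff 3) h
  have h2 := congrArg (fun q : R[X] => q.coeff 2) h
  have h0 := congrArg (fun q : R[X] => q.coeff 0) h
  simp only [coeff_add, coeff_sub, coeff_one, coeff_C_mul, coeff_X_pow, coeff_X, coeff_C] at h3 h2 h0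
  norm_num at h3 h2 h0
  exact ⟨h3, h2, h0⟩

/-- `X⁴ − X² + 1` has no root modulo `4`. -/
theorem zmod4_no_root : ∀ x : ZMod 4, x ^ 4 - x ^ 2 + 1 ≠ 0 := by decide

/-- The coefficient system of a factorisation into monic quadratics has no solution modulo `4`
(`bd = 1 ⟹ d = b`; `c = −a`; then `a² = 2b + 1 ≡ 3 (mod 4)`, impossible). -/
theorem zmod4_no_quad : ∀ a b c d : ZMod 4, a + c = 0 → a * c + b + d = -1 → b * d = 1 → False := by
  decide

/-- `Φ₁₂` is irreducible over `ℤ₂`: a monic factor of degree `1` gives a root of `X⁴ − X² + 1`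
in `ℤ₂`, a monic factor of degree `2` gives a solution of the coefficient system in `ℤ₂`; both
are refuted in `ℤ₂/4ℤ₂ = ℤ/4` (`PadicInt.toZModPow 2`). -/
theorem cyclotomic_twelve_irreducible_padicInt : Irreducible (cyclotomic 12 ℤ_[2]) := by
  have hmonic : (cyclotomic 12 ℤ_[2]).Monic := cyclotomic.monic 12 _
  have hdeg : (cyclotomic 12 ℤ_[2]).natDegree = 4 := by
    rw [natDegree_cyclotomic]
    decide
  let ψ : ℤ_[2] →+* ZMod 4 := PadicInt.toZModPow 2
  rw [hmonic.irreducible_iff_natDegree']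
  refine ⟨?_, ?_⟩
  · intro h1
    have := congrArg natDegree h1
    rw [hdeg, natDegree_one] at this
    exact absurd this (by norm_num)
  · intro f g hf hg hfg
    rw [hdeg, Finset.mem_Ioc, not_and_or, not_lt, not_le]
    by_contra hcon
    rw [not_or, not_le, not_lt] at hcon
    obtain ⟨hpos, hle⟩ := hcon
    norm_num at hle
    have hfg' : f * g = X ^ 4 - X ^ 2 + 1 := by rw [hfg, cyclotomic_twelve]
    interval_cases hd : g.natDegree
    · -- a linear monic factor: a root `r = -g₀` of `X⁴ − X² + 1` in `ℤ₂`
      have hg1 : g = X + C (g.coeff 0) := by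
        nth_rewrite 1 [hg.as_sum]
        rw [hd]
        simp
      obtain ⟨r, hr⟩ : ∃ r : ℤ_[2], r = -g.coeff 0 := ⟨_, rfl⟩
      have hev : (X ^ 4 - X ^ 2 + 1 : ℤ_[2][X]).eval r = 0 := by
        rw [← hfg', eval_mul, hg1]
        simp [hr]
      simp only [eval_add, eval_sub, eval_pow, eval_X, eval_one] at hev
      have h4 := congrArg ψ hev
      simp only [map_add, map_sub, map_pow, map_one, map_zero] at h4
      exact zmod4_no_root (ψ r) h4
    · -- two monic quadratic factors
      have hf2 : f.natDegree = 2 := by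
        have := hf.natDegree_mul hg
        rw [hfg, hdeg, hd] at this
        omega
      have hfq : f = X ^ 2 + C (f.coeff 1) * X + C (f.coeff 0) := by
        nth_rewrite 1 [hf.as_sum]
        rw [hf2]
        simp [Finset.sum_range_succ]
        ring
      have hgq : g = X ^ 2 + C (g.coeff 1) * X + C (g.coeff 0) := by
        nth_rewrite 1 [hg.as_sum]
        rw [hd]
        simp [Finset.sum_range_succ]
        ring
      have hP : (X ^ 2 + C (f.coeff 1) * X + C (f.coeff 0)) *
          (X ^ 2 + C (g.coeff 1) * X + C (g.coeff 0)) = (X ^ 4 - X ^ 2 + 1 : ℤ_[2][X]) := by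
        rw [← hfq, ← hgq, hfg']
      obtain ⟨e1, e2, e3⟩ := coeffs_of_quad_mul_quad hP
      have f1 := congrArg ψ e1
      have f2 := congrArg ψ e2
      have f3 := congrArg ψ e3
      simp only [map_add, map_mul, map_neg, map_one, map_zero] at f1 f2 f3
      exact zmod4_no_quad _ _ _ _ f1 f2 f3

/-- **R211 (k3-g33 F-DEG `CyclotomicTwelveIrreducible`) CLOSED:** `Φ₁₂` is irreducible over
`ℚ₂`, i.e. `[ℚ₂(ζ₁₂) : ℚ₂] = 4` (`L_1 = CyclotomicField 12 ℚ_[2]` is the layer-1 frame field of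
record, B55).  Gauss's lemma (`ℤ₂` integrally closed, `ℚ₂ = Frac ℤ₂`) transports the `ℤ₂`
statement. -/
theorem cyclotomicTwelveIrreducible : Irreducible (Polynomial.cyclotomic 12 ℚ_[2]) := by
  have h := (cyclotomic.monic 12 ℤ_[2]).irreducible_iff_irreducible_map_fraction_map (K := ℚ_[2])
  rw [map_cyclotomic] at h
  exact h.mp cyclotomic_twelve_irreducible_padicInt

end CyclotomicTwelve

end Summit.BirchSwinnertonDyer.BirchSwinnertonDyer.Cruxes.SplitBadTwoLowerHalfOfFacts.UniversalNormsK2G35
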